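import Mathlib.Analysis.InnerProductSpace.Spectrum
import Mathlib.Analysis.InnerProductSpace.Adjoint
import Mathlib.Analysis.Calculus.InverseFunctionTheorem.ContDiff
import Mathlib.Analysis.Calculus.FDeriv.Mul
import Mathlib.Analysis.Calculus.ContDiff.Operations
import Mathlib.Analysis.Normed.Ring.Units
import Mathlib.Topology.Algebra.Module.FiniteDimension
import HarnessLib

/-!
# The positive square root of a positive definite operator depends smoothly on the operator

Finite-dimensional real inner product space `V`, the algebra `V →L[ℝ] V`. For a symmetric
positive definite operator `P` (`IsPosDefSymm P`), the positive square root `posSqrt P` (diagonal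
with entries `√λᵢ` in an orthonormal eigenbasis — Mathlib's spectral theorem
`LinearMap.IsSymmetric.eigenvectorBasis`) is the UNIQUE symmetric positive definite `S` with
`S * S = P` (`IsPosDefSymm.eq_of_mul_self_eq`), and the map `P ↦ √P` is `C^∞` on the set of
symmetric positive definite operators (`contDiffOn_posSqrt`), as is `P ↦ (√P)⁻¹`
(`contDiffOn_inverse_posSqrt`).

The smoothness proof is the inverse function theorem at a general positive definite `S`
(compare `LocalSqrtNearOneProofs.lean`, the case `S = 1` in an abstract Banach algebra): the
derivative of squaring at `S` is the Lyapunov operator `H ↦ S H + H S` (`mulSymm S`), which is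
injective — if `S H + H S = 0` then for an eigenvector `bᵢ` of `S` (`S bᵢ = σᵢ bᵢ`, `σᵢ > 0`),
`(S + σᵢ) (H bᵢ) = 0` forces `H bᵢ = 0` — hence invertible (`mulSymmEquiv`); the local inverse of
squaring near `S * S` (`localSqrtAt`) is `C^∞`, takes symmetric values on symmetric arguments
(uniqueness near `S`, applied to the adjoint) and positive definite values near `S * S`
(positivity is an open condition, `isOpen_setOf_inner_pos`), so by uniqueness of positive square
roots it agrees with `posSqrt` on the symmetric positive definite operators near `S * S`.

Motivation in this tree: the smooth dependence of the compatible complex structure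
`J_{g,ω} = (-A²)^{-1/2} A` on `(g, ω)` (McDuff–Salamon 2017, Prop. 2.5.6 / Exercise 2.5.15;
`Literature/Geometry/Symplectic/CompatibleComplexStructure.lean`), i.e. the global existence of
`ω`-compatible almost complex structures (Prop. 4.1.1 (i)). Everything is proved; no named facts.

## References

* D. McDuff, D. Salamon, *Introduction to Symplectic Topology*, 3rd ed. (2017), Prop. 2.5.6,
  Step 1 and Exercise 2.5.15 (uniqueness and smoothness of the positive square root).
  [McDuffSalamon2017]
* (Inverse function theorem) Mathlib, `Mathlib/Analysis/Calculus/InverseFunctionTheorem/`.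
-/

noncomputable section

open scoped Topology ContDiff RealInnerProductSpace
open Filter Module Finset

namespace Literature.Analysis.OperatorTheory

variable {V : Type*} [NormedAddCommGroup V] [InnerProductSpace ℝ V]

/-! ### Symmetric positive definite operators -/

/-- A continuous operator on a real inner product space is **symmetric positive definite**:
`⟪T x, y⟫ = ⟪x, T y⟫` and `⟪T v, v⟫ > 0` for `v ≠ 0`. [folklore] -/
structure IsPosDefSymm (T : V →L[ℝ] V) : Prop where
  /-- symmetry -/
  symm : ∀ x y, ⟪T x, y⟫ = ⟪x, T y⟫
  /-- positive definiteness -/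
  pos : ∀ v, v ≠ 0 → 0 < ⟪T v, v⟫

namespace IsPosDefSymm

variable {T : V →L[ℝ] V}

/-- The underlying linear map of a symmetric positive definite operator is symmetric.
[folklore] -/
theorem isSymmetric (h : IsPosDefSymm T) : (T : V →ₗ[ℝ] V).IsSymmetric := fun x y ↦ h.symm x y

/-- `⟪T v, v⟫ ≥ 0`. [folklore] -/
theorem nonneg (h : IsPosDefSymm T) (v : V) : 0 ≤ ⟪T v, v⟫ := by
  by_cases hv : v = 0
  · rw [hv, inner_zero_right]
  · exact (h.pos v hv).le

/-- A symmetric positive definite operator has trivial kernel. [folklore] -/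
theorem apply_ne_zero (h : IsPosDefSymm T) {v : V} (hv : v ≠ 0) : T v ≠ 0 := by
  intro h0
  have := h.pos v hv
  rw [h0, inner_zero_left] at this
  exact lt_irrefl 0 this

/-- A symmetric positive definite operator is injective. [folklore] -/
theorem injective (h : IsPosDefSymm T) : Function.Injective T := by
  intro x y hxy
  by_contra hne
  have h1 : T (x - y) = 0 := by rw [map_sub, hxy, sub_self]
  exact h.apply_ne_zero (sub_ne_zero.2 hne) h1

/-- `T + c` is symmetric positive definite for `c ≥ 0`. [folklore] -/
theorem add_smul_one (h : IsPosDefSymm T) {c : ℝ} (hc : 0 ≤ c) : IsPosDefSymm (T + c • 1) := by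
  refine ⟨fun x y ↦ ?_, fun v hv ↦ ?_⟩
  · change ⟪T x + c • x, y⟫ = ⟪x, T y + c • y⟫
    rw [inner_add_left, inner_add_right, h.symm x y, real_inner_smul_left, real_inner_smul_right]
  · change 0 < ⟪T v + c • v, v⟫
    rw [inner_add_left, real_inner_smul_left]
    have h1 := h.pos v hv
    have h2 : 0 ≤ c * ⟪v, v⟫ := mul_nonneg hc real_inner_self_nonneg
    linarith

/-- The product `S * S` of a symmetric positive definite operator with itself is symmetric
positive definite. [folklore] -/
theorem mul_self (h : IsPosDefSymm T) : IsPosDefSymm (T * T) := by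
  refine ⟨fun x y ↦ ?_, fun v hv ↦ ?_⟩
  · change ⟪T (T x), y⟫ = ⟪x, T (T y)⟫
    rw [h.symm, h.symm]
  · change 0 < ⟪T (T v), v⟫
    rw [h.symm, real_inner_self_eq_norm_sq]
    have := h.apply_ne_zero hv
    positivity

end IsPosDefSymm

/-! ### Positivity is an open condition -/

section Open

variable [FiniteDimensional ℝ V]

/-- **Positive definiteness is an open condition** on `V →L[ℝ] V` (finite-dimensional `V`): the
set of `T` with `⟪T v, v⟫ > 0` for all `v ≠ 0` is open (compactness of the unit sphere). [folklore] -/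
theorem isOpen_setOf_inner_pos : IsOpen {T : V →L[ℝ] V | ∀ v, v ≠ 0 → 0 < ⟪T v, v⟫} := by
  rw [isOpen_iff_mem_nhds]
  intro T₀ hT₀
  have hK : IsCompact (Metric.sphere (0 : V) 1) := isCompact_sphere 0 1
  have hcont : Continuous fun z : (V →L[ℝ] V) × V ↦ ⟪z.1 z.2, z.2⟫ :=
    (isBoundedBilinearMap_apply.continuous).inner continuous_snd
  have hev : ∀ v ∈ Metric.sphere (0 : V) 1, ∀ᶠ z in 𝓝 (T₀, v),
      0 < ⟪(z : (V →L[ℝ] V) × V).1 z.2, z.2⟫ := by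
    intro v hv
    have hv0 : v ≠ 0 := by
      intro h
      rw [h, Metric.mem_sphere, dist_self] at hv
      exact zero_ne_one hv
    exact (hcont.continuousAt (x := (T₀, v))).eventually_const_lt (hT₀ v hv0)
  have h := hK.eventually_forall_of_forall_eventually
    (P := fun (T : V →L[ℝ] V) (v : V) ↦ 0 < ⟪T v, v⟫) hev
  filter_upwards [h] with T hT v hv
  have hn : ‖v‖ ≠ 0 := norm_ne_zero_iff.2 hv
  have hu : ‖v‖⁻¹ • v ∈ Metric.sphere (0 : V) 1 := by
    rw [Metric.mem_sphere, dist_zero_right, norm_smul, norm_inv, norm_norm, inv_mul_cancel₀ hn]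
  have h1 := hT _ hu
  rw [map_smul, real_inner_smul_left, real_inner_smul_right, ← mul_assoc] at h1
  have h2 : 0 < ‖v‖⁻¹ * ‖v‖⁻¹ := mul_pos (inv_pos.2 (norm_pos_iff.2 hv)) (inv_pos.2 (norm_pos_iff.2 hv))
  exact pos_of_mul_pos_right h1 h2.le

end Open

/-! ### Diagonal operators in an orthonormal basis -/

section Diag

variable [FiniteDimensional ℝ V] {ι : Type*} [Fintype ι] [DecidableEq ι]

/-- The operator diagonal in the orthonormal basis `b` with entries `d`:
`x ↦ Σᵢ dᵢ ⟪bᵢ, x⟫ bᵢ`. [folklore] -/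
def diagOp (b : OrthonormalBasis ι ℝ V) (d : ι → ℝ) : V →L[ℝ] V :=
  LinearMap.toContinuousLinearMap
    { toFun := fun x ↦ ∑ i, (d i * ⟪b i, x⟫) • b i
      map_add' := fun x y ↦ by
        rw [← Finset.sum_add_distrib]
        refine Finset.sum_congr rfl fun i _ ↦ ?_
        rw [inner_add_right, mul_add, add_smul]
      map_smul' := fun c x ↦ by
        rw [RingHom.id_apply, Finset.smul_sum]
        refine Finset.sum_congr rfl fun i _ ↦ ?_
        rw [real_inner_smul_right, smul_smul]
        congr 1
        ring }

omit [DecidableEq ι] in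
/-- Unfolding `diagOp`. [folklore] -/
theorem diagOp_apply (b : OrthonormalBasis ι ℝ V) (d : ι → ℝ) (x : V) :
    diagOp b d x = ∑ i, (d i * ⟪b i, x⟫) • b i := rfl

omit [FiniteDimensional ℝ V] in
/-- Coefficients of a combination of an orthonormal basis: `⟪bⱼ, Σ cᵢ bᵢ⟫ = cⱼ`. [folklore] -/
theorem inner_basis_sum_smul (b : OrthonormalBasis ι ℝ V) (c : ι → ℝ) (j : ι) :
    ⟪b j, ∑ i, c i • b i⟫ = c j := by
  rw [inner_sum]
  simp only [real_inner_smul_right, b.inner_eq_ite]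
  simp [Finset.sum_ite_eq, Finset.mem_univ]

omit [FiniteDimensional ℝ V] [DecidableEq ι] in
/-- Two vectors with the same coefficients on an orthonormal basis are equal. [folklore] -/
theorem ext_inner_basis (b : OrthonormalBasis ι ℝ V) {x y : V}
    (h : ∀ j, ⟪b j, x⟫ = ⟪b j, y⟫) : x = y := by
  rw [← b.sum_repr' x, ← b.sum_repr' y]
  exact Finset.sum_congr rfl fun j _ ↦ by rw [h j]

/-- `⟪bⱼ, D x⟫ = dⱼ ⟪bⱼ, x⟫` for the diagonal operator `D = diagOp b d`. [folklore] -/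
theorem inner_basis_diagOp (b : OrthonormalBasis ι ℝ V) (d : ι → ℝ) (j : ι) (x : V) :
    ⟪b j, diagOp b d x⟫ = d j * ⟪b j, x⟫ :=
  inner_basis_sum_smul b _ j

/-- `D bⱼ = dⱼ bⱼ`. [folklore] -/
theorem diagOp_basis (b : OrthonormalBasis ι ℝ V) (d : ι → ℝ) (j : ι) :
    diagOp b d (b j) = d j • b j := by
  refine ext_inner_basis b fun i ↦ ?_
  rw [inner_basis_diagOp, real_inner_smul_right, b.inner_eq_ite]
  split_ifs <;> simp_all

omit [DecidableEq ι] in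
/-- A diagonal operator is symmetric. [folklore] -/
theorem diagOp_symm (b : OrthonormalBasis ι ℝ V) (d : ι → ℝ) (x y : V) :
    ⟪diagOp b d x, y⟫ = ⟪x, diagOp b d y⟫ := by
  have hx : ⟪diagOp b d x, y⟫ = ∑ i, d i * ⟪b i, x⟫ * ⟪b i, y⟫ := by
    simp only [diagOp_apply, sum_inner, real_inner_smul_left]
  have hy : ⟪x, diagOp b d y⟫ = ∑ i, d i * ⟪b i, y⟫ * ⟪b i, x⟫ := by
    rw [real_inner_comm]
    simp only [diagOp_apply, sum_inner, real_inner_smul_left]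
  rw [hx, hy]
  exact Finset.sum_congr rfl fun i _ ↦ by ring

omit [DecidableEq ι] in
/-- `⟪D x, x⟫ = Σ dᵢ ⟪bᵢ, x⟫²`. [folklore] -/
theorem inner_diagOp_self (b : OrthonormalBasis ι ℝ V) (d : ι → ℝ) (x : V) :
    ⟪diagOp b d x, x⟫ = ∑ i, d i * (⟪b i, x⟫ * ⟪b i, x⟫) := by
  simp only [diagOp_apply, sum_inner, real_inner_smul_left]
  exact Finset.sum_congr rfl fun i _ ↦ by ring

omit [DecidableEq ι] in
/-- A diagonal operator with positive entries is symmetric positive definite. [folklore] -/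
theorem isPosDefSymm_diagOp (b : OrthonormalBasis ι ℝ V) {d : ι → ℝ} (hd : ∀ i, 0 < d i) :
    IsPosDefSymm (diagOp b d) := by
  refine ⟨diagOp_symm b d, fun x hx ↦ ?_⟩
  rw [inner_diagOp_self]
  obtain ⟨j, hj⟩ : ∃ j, ⟪b j, x⟫ ≠ 0 := by
    by_contra h
    push Not at h
    apply hx
    rw [← b.sum_repr' x]
    exact Finset.sum_eq_zero fun i _ ↦ by rw [h i, zero_smul]
  refine Finset.sum_pos' (fun i _ ↦ ?_) ⟨j, Finset.mem_univ j, ?_⟩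
  · exact mul_nonneg (hd i).le (mul_self_nonneg _)
  · exact mul_pos (hd j) (mul_self_pos.2 hj)

/-- Composition of diagonal operators multiplies the entries. [folklore] -/
theorem diagOp_mul_diagOp (b : OrthonormalBasis ι ℝ V) (d d' : ι → ℝ) :
    diagOp b d * diagOp b d' = diagOp b (fun i ↦ d i * d' i) := by
  refine ContinuousLinearMap.ext fun x ↦ ext_inner_basis b fun j ↦ ?_
  change ⟪b j, diagOp b d (diagOp b d' x)⟫ = _
  rw [inner_basis_diagOp, inner_basis_diagOp, inner_basis_diagOp, mul_assoc]

/-- An operator acting diagonally on an orthonormal basis IS the diagonal operator. [folklore] -/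
theorem eq_diagOp_of_apply_basis (b : OrthonormalBasis ι ℝ V) (d : ι → ℝ) {T : V →L[ℝ] V}
    (h : ∀ i, T (b i) = d i • b i) : T = diagOp b d := by
  have h' : (T : V →ₗ[ℝ] V) = (diagOp b d : V →ₗ[ℝ] V) := by
    refine b.toBasis.ext fun i ↦ ?_
    simp only [OrthonormalBasis.coe_toBasis, ContinuousLinearMap.coe_coe]
    rw [h i, diagOp_basis]
  exact ContinuousLinearMap.coe_injective h'

end Diag

/-! ### The positive square root -/

section Sqrt

variable [FiniteDimensional ℝ V]

/-- **The positive square root** `√T` of an operator: for symmetric `T`, the operator acting as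
`√λᵢ` on an orthonormal eigenbasis (`λᵢ` the eigenvalues; spectral theorem); the junk value `0`
otherwise. For `T` symmetric positive definite this is the unique symmetric positive definite
square root (`IsPosDefSymm.eq_of_mul_self_eq`). [folklore] -/
def posSqrt (T : V →L[ℝ] V) : V →L[ℝ] V :=
  open Classical in
  if h : (T : V →ₗ[ℝ] V).IsSymmetric then
    diagOp (h.eigenvectorBasis rfl) fun i ↦ Real.sqrt (h.eigenvalues rfl i)
  else 0

/-- A symmetric operator is diagonal in its eigenbasis. [folklore] -/
theorem eq_diagOp_eigenvalues {T : V →L[ℝ] V} (h : (T : V →ₗ[ℝ] V).IsSymmetric) :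
    T = diagOp (h.eigenvectorBasis rfl) (fun i ↦ h.eigenvalues rfl i) := by
  refine eq_diagOp_of_apply_basis _ _ fun i ↦ ?_
  have h1 := h.apply_eigenvectorBasis rfl i
  exact h1

/-- The eigenvalues of a symmetric positive definite operator are positive. [folklore] -/
theorem IsPosDefSymm.eigenvalues_pos {T : V →L[ℝ] V} (h : IsPosDefSymm T)
    (i : Fin (finrank ℝ V)) : 0 < h.isSymmetric.eigenvalues rfl i := by
  set b := h.isSymmetric.eigenvectorBasis rfl with hb
  have h1 : T (b i) = h.isSymmetric.eigenvalues rfl i • b i := h.isSymmetric.apply_eigenvectorBasis rfl i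
  have h2 := h.pos (b i) (b.toBasis.ne_zero i)
  rw [h1, real_inner_smul_left, b.inner_eq_ite, if_pos rfl, mul_one] at h2
  exact h2

/-- Unfolding `posSqrt` on a symmetric positive definite operator. [folklore] -/
theorem IsPosDefSymm.posSqrt_eq {T : V →L[ℝ] V} (h : IsPosDefSymm T) :
    posSqrt T = diagOp (h.isSymmetric.eigenvectorBasis rfl)
      fun i ↦ Real.sqrt (h.isSymmetric.eigenvalues rfl i) := by
  rw [posSqrt, dif_pos h.isSymmetric]

/-- **`√T` is symmetric positive definite** for `T` symmetric positive definite. [folklore] -/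
theorem IsPosDefSymm.isPosDefSymm_posSqrt {T : V →L[ℝ] V} (h : IsPosDefSymm T) :
    IsPosDefSymm (posSqrt T) := by
  rw [h.posSqrt_eq]
  exact isPosDefSymm_diagOp _ fun i ↦ Real.sqrt_pos.2 (h.eigenvalues_pos i)

/-- **`√T · √T = T`** for `T` symmetric positive definite. [folklore] -/
theorem IsPosDefSymm.posSqrt_mul_posSqrt {T : V →L[ℝ] V} (h : IsPosDefSymm T) :
    posSqrt T * posSqrt T = T := by
  rw [h.posSqrt_eq, diagOp_mul_diagOp]
  conv_rhs => rw [eq_diagOp_eigenvalues h.isSymmetric]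
  congr 1
  funext i
  exact Real.mul_self_sqrt (h.eigenvalues_pos i).le

/-- **Uniqueness of symmetric positive definite square roots**: if `S` and `R` are symmetric
positive definite with `S · S = R · R` then `S = R`. Proof: for an eigenvector `bᵢ` of `S`
(`S bᵢ = σᵢ bᵢ`, `σᵢ > 0`), `(R + σᵢ)((R - σᵢ) bᵢ) = (R² - σᵢ²) bᵢ = 0` and `R + σᵢ` is injective,
so `R bᵢ = σᵢ bᵢ = S bᵢ`. [cite: McDuffSalamon2017, Exercise 2.5.15] -/
theorem IsPosDefSymm.eq_of_mul_self_eq {S R : V →L[ℝ] V} (hS : IsPosDefSymm S) (hR : IsPosDefSymm R)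
    (h : S * S = R * R) : S = R := by
  set b := hS.isSymmetric.eigenvectorBasis rfl with hb
  set σ := hS.isSymmetric.eigenvalues rfl with hσ
  have hSb : ∀ i, S (b i) = σ i • b i := fun i ↦ hS.isSymmetric.apply_eigenvectorBasis rfl i
  have hRb : ∀ i, R (b i) = σ i • b i := by
    intro i
    have hσi : 0 < σ i := hS.eigenvalues_pos i
    -- `(R + σᵢ) (R bᵢ - σᵢ bᵢ) = R (R bᵢ) - σᵢ² bᵢ = S (S bᵢ) - σᵢ² bᵢ = 0`
    have h1 : (R + σ i • 1) (R (b i) - σ i • b i) = 0 := by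
      have h2 : R (R (b i)) = S (S (b i)) := (congrArg (fun T : V →L[ℝ] V ↦ T (b i)) h).symm
      change R (R (b i) - σ i • b i) + σ i • (R (b i) - σ i • b i) = 0
      rw [map_sub, map_smul, h2, hSb, map_smul, hSb, smul_sub]
      abel
    have h3 := (hR.add_smul_one hσi.le).injective (a₁ := R (b i) - σ i • b i) (a₂ := 0)
      (by rw [h1, map_zero])
    exact sub_eq_zero.1 h3
  have hS' : S = diagOp b σ := eq_diagOp_of_apply_basis b σ hSb
  have hR' : R = diagOp b σ := eq_diagOp_of_apply_basis b σ hRb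
  rw [hS', hR']

/-- The positive square root of a symmetric positive definite operator is characterised by
`S` symmetric positive definite and `S · S = T`. [cite: McDuffSalamon2017, Exercise 2.5.15] -/
theorem IsPosDefSymm.posSqrt_unique {T S : V →L[ℝ] V} (hT : IsPosDefSymm T) (hS : IsPosDefSymm S)
    (h : S * S = T) : S = posSqrt T :=
  hS.eq_of_mul_self_eq hT.isPosDefSymm_posSqrt (by rw [h, hT.posSqrt_mul_posSqrt])

/-- A symmetric positive definite operator is a unit of `V →L[ℝ] V`. [folklore] -/
theorem IsPosDefSymm.isUnit {T : V →L[ℝ] V} (h : IsPosDefSymm T) : IsUnit T := by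
  have hb : Function.Bijective T :=
    ⟨h.injective, LinearMap.injective_iff_surjective.1 (show Function.Injective (T : V →ₗ[ℝ] V) from h.injective)⟩
  let e : V ≃L[ℝ] V := LinearEquiv.toContinuousLinearEquiv (LinearEquiv.ofBijective (T : V →ₗ[ℝ] V) hb)
  have he : (e : V →L[ℝ] V) = T := by
    ext v
    rfl
  rw [← he]
  exact ⟨e.toUnit, rfl⟩

end Sqrt

/-! ### The derivative of squaring: the Lyapunov operator `H ↦ S H + H S` -/

section Lyapunov

/-- **The Lyapunov operator** `H ↦ S H + H S`, the derivative of `X ↦ X · X` at `S`. [folklore] -/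
def mulSymm (S : V →L[ℝ] V) : (V →L[ℝ] V) →L[ℝ] (V →L[ℝ] V) :=
  S • ContinuousLinearMap.id ℝ (V →L[ℝ] V) + (ContinuousLinearMap.id ℝ (V →L[ℝ] V)).smulRight S

/-- `mulSymm S H = S H + H S`. [folklore] -/
@[simp] theorem mulSymm_apply (S H : V →L[ℝ] V) : mulSymm S H = S * H + H * S := by
  simp [mulSymm]

/-- **The strict derivative of squaring at `S` is the Lyapunov operator.** [folklore] -/
theorem hasStrictFDerivAt_mul_self (S : V →L[ℝ] V) :
    HasStrictFDerivAt (fun X : V →L[ℝ] V ↦ X * X) (mulSymm S) S := by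
  have h := (hasStrictFDerivAt_id (𝕜 := ℝ) S).mul' (hasStrictFDerivAt_id (𝕜 := ℝ) S)
  refine h.congr_fderiv ?_
  ext H v
  simp [mulSymm]

variable [FiniteDimensional ℝ V]

/-- **The Lyapunov operator of a symmetric positive definite `S` is injective**: if
`S H + H S = 0` then `(S + σᵢ)(H bᵢ) = 0` for every eigenvector `bᵢ` of `S`, so `H bᵢ = 0`.
[folklore] -/
theorem mulSymm_injective {S : V →L[ℝ] V} (hS : IsPosDefSymm S) : Function.Injective (mulSymm S) := by
  rw [injective_iff_map_eq_zero]
  intro H hH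
  rw [mulSymm_apply] at hH
  set b := hS.isSymmetric.eigenvectorBasis rfl with hb
  set σ := hS.isSymmetric.eigenvalues rfl with hσ
  have hHb : ∀ i, H (b i) = 0 := by
    intro i
    have hσi : 0 < σ i := hS.eigenvalues_pos i
    have hSb : S (b i) = σ i • b i := hS.isSymmetric.apply_eigenvectorBasis rfl i
    have h1 : (S + σ i • 1) (H (b i)) = 0 := by
      have h2 : S (H (b i)) + H (S (b i)) = 0 := congrArg (fun T : V →L[ℝ] V ↦ T (b i)) hH
      rw [hSb, map_smul] at h2
      exact h2
    exact (hS.add_smul_one hσi.le).injective (by rw [h1, map_zero])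
  have h' : (H : V →ₗ[ℝ] V) = 0 := b.toBasis.ext fun i ↦ by
    simp only [OrthonormalBasis.coe_toBasis, ContinuousLinearMap.coe_coe, LinearMap.zero_apply]
    exact hHb i
  exact ContinuousLinearMap.coe_injective h'

/-- **The Lyapunov operator of a symmetric positive definite `S` is invertible** (injective
endomorphism of a finite-dimensional space), as a continuous linear equivalence. [folklore] -/
def mulSymmEquiv {S : V →L[ℝ] V} (hS : IsPosDefSymm S) : (V →L[ℝ] V) ≃L[ℝ] (V →L[ℝ] V) :=
  LinearEquiv.toContinuousLinearEquiv
    (LinearEquiv.ofBijective (mulSymm S).toLinearMap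
      ⟨mulSymm_injective hS,
        LinearMap.injective_iff_surjective.1 (mulSymm_injective hS)⟩)

/-- The equivalence `mulSymmEquiv` is the Lyapunov operator. [folklore] -/
@[simp] theorem coe_mulSymmEquiv {S : V →L[ℝ] V} (hS : IsPosDefSymm S) :
    (mulSymmEquiv hS : (V →L[ℝ] V) →L[ℝ] (V →L[ℝ] V)) = mulSymm S := by
  ext H v
  rfl

/-- The strict derivative of squaring at a symmetric positive definite `S`, as an invertible
operator (input of the inverse function theorem). [folklore] -/
theorem hasStrictFDerivAt_mul_self_equiv {S : V →L[ℝ] V} (hS : IsPosDefSymm S) :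
    HasStrictFDerivAt (fun X : V →L[ℝ] V ↦ X * X)
      (mulSymmEquiv hS : (V →L[ℝ] V) →L[ℝ] (V →L[ℝ] V)) S := by
  rw [coe_mulSymmEquiv]
  exact hasStrictFDerivAt_mul_self S

end Lyapunov

/-! ### The local square root near `S · S` and the smoothness of `posSqrt` -/

section Smooth

variable [FiniteDimensional ℝ V] [CompleteSpace V]

/-- **The local square root near `S · S`**: the local inverse of squaring at a symmetric positive
definite `S` given by the inverse function theorem. [folklore] -/
def localSqrtAt {S : V →L[ℝ] V} (hS : IsPosDefSymm S) : (V →L[ℝ] V) → (V →L[ℝ] V) :=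
  (hasStrictFDerivAt_mul_self_equiv hS).localInverse (fun X : V →L[ℝ] V ↦ X * X) _ S

/-- `√X · √X = X` near `S · S`. [folklore] -/
theorem eventually_localSqrtAt_mul_self {S : V →L[ℝ] V} (hS : IsPosDefSymm S) :
    ∀ᶠ X in 𝓝 (S * S), localSqrtAt hS X * localSqrtAt hS X = X :=
  (hasStrictFDerivAt_mul_self_equiv hS).eventually_right_inverse

/-- `√(S · S) = S`. [folklore] -/
theorem localSqrtAt_mul_self {S : V →L[ℝ] V} (hS : IsPosDefSymm S) : localSqrtAt hS (S * S) = S :=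
  (hasStrictFDerivAt_mul_self_equiv hS).localInverse_apply_image

/-- **Uniqueness near `S`**: `√(Y · Y) = Y` for `Y` near `S`. [folklore] -/
theorem eventually_localSqrtAt_of_mul_self {S : V →L[ℝ] V} (hS : IsPosDefSymm S) :
    ∀ᶠ Y in 𝓝 S, localSqrtAt hS (Y * Y) = Y :=
  (hasStrictFDerivAt_mul_self_equiv hS).eventually_left_inverse

/-- The local square root is continuous at `S · S`. [folklore] -/
theorem continuousAt_localSqrtAt {S : V →L[ℝ] V} (hS : IsPosDefSymm S) :
    ContinuousAt (localSqrtAt hS) (S * S) :=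
  (hasStrictFDerivAt_mul_self_equiv hS).localInverse_continuousAt

/-- **The local square root is `C^∞` at `S · S`** (inverse function theorem). [folklore] -/
theorem contDiffAt_localSqrtAt {S : V →L[ℝ] V} (hS : IsPosDefSymm S) :
    ContDiffAt ℝ ∞ (localSqrtAt hS) (S * S) := by
  have hf : ContDiffAt ℝ ∞ (fun X : V →L[ℝ] V ↦ X * X) S := contDiffAt_id.mul contDiffAt_id
  have h := hf.to_localInverse (hasStrictFDerivAt_mul_self_equiv hS).hasFDerivAt (by simp)
  exact h

/-- **The local square root of a self-adjoint operator is self-adjoint** near `S · S` (uniqueness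
near `S` applied to the adjoint `star (√X)`, a square root of `star X = X` close to `star S = S`).
[folklore] -/
theorem eventually_localSqrtAt_star {S : V →L[ℝ] V} (hS : IsPosDefSymm S) :
    ∀ᶠ X in 𝓝 (S * S), (star X = X → star (localSqrtAt hS X) = localSqrtAt hS X) := by
  have hSa : star S = S := (hS.isSymmetric.isSelfAdjoint).star_eq
  have hc : ContinuousAt (fun X ↦ star (localSqrtAt hS X)) (S * S) :=
    continuousAt_star.comp (continuousAt_localSqrtAt hS)
  have ht : ∀ᶠ Y in 𝓝 ((fun X ↦ star (localSqrtAt hS X)) (S * S)), localSqrtAt hS (Y * Y) = Y := by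
    simp only [localSqrtAt_mul_self, hSa]
    exact eventually_localSqrtAt_of_mul_self hS
  filter_upwards [hc.eventually ht, eventually_localSqrtAt_mul_self hS] with X hX hXX hsX
  have hY : star (localSqrtAt hS X) * star (localSqrtAt hS X) = X := by rw [← star_mul, hXX, hsX]
  rw [hY] at hX
  exact hX.symm

/-- The local square root is positive definite near `S · S` (it is close to `S`, and positivity
is an open condition). [folklore] -/
theorem eventually_localSqrtAt_pos {S : V →L[ℝ] V} (hS : IsPosDefSymm S) :
    ∀ᶠ X in 𝓝 (S * S), ∀ v, v ≠ 0 → 0 < ⟪localSqrtAt hS X v, v⟫ := by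
  have h : {T : V →L[ℝ] V | ∀ v, v ≠ 0 → 0 < ⟪T v, v⟫} ∈ 𝓝 (localSqrtAt hS (S * S)) := by
    rw [localSqrtAt_mul_self]
    exact isOpen_setOf_inner_pos.mem_nhds hS.pos
  exact (continuousAt_localSqrtAt hS).preimage_mem_nhds h

/-- **Near `S · S`, the local square root IS the positive square root** on symmetric positive
definite operators: there `√X` is symmetric (the adjoint argument), positive definite, and
squares to `X`, so it is `posSqrt X` by uniqueness. [folklore] -/
theorem eventually_posSqrt_eq_localSqrtAt {S : V →L[ℝ] V} (hS : IsPosDefSymm S) :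
    ∀ᶠ X in 𝓝 (S * S), IsPosDefSymm X → posSqrt X = localSqrtAt hS X := by
  filter_upwards [eventually_localSqrtAt_star hS, eventually_localSqrtAt_pos hS,
    eventually_localSqrtAt_mul_self hS] with X hstar hpos hXX hX
  have hXa : star X = X := (hX.isSymmetric.isSelfAdjoint).star_eq
  have hsymm : ((localSqrtAt hS X : V →L[ℝ] V) : V →ₗ[ℝ] V).IsSymmetric :=
    ContinuousLinearMap.isSelfAdjoint_iff_isSymmetric.1 (hstar hXa)
  have hR : IsPosDefSymm (localSqrtAt hS X) := ⟨fun x y ↦ hsymm x y, hpos⟩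
  exact (hX.posSqrt_unique hR hXX).symm

/-- **`posSqrt` is `C^∞` at every symmetric positive definite operator, within the symmetric
positive definite operators.** [cite: McDuffSalamon2017, Exercise 2.5.15] -/
theorem contDiffWithinAt_posSqrt {P : V →L[ℝ] V} (hP : IsPosDefSymm P) :
    ContDiffWithinAt ℝ ∞ posSqrt {T : V →L[ℝ] V | IsPosDefSymm T} P := by
  have hS := hP.isPosDefSymm_posSqrt
  have hSS : posSqrt P * posSqrt P = P := hP.posSqrt_mul_posSqrt
  have h1 : ContDiffWithinAt ℝ ∞ (localSqrtAt hS) {T : V →L[ℝ] V | IsPosDefSymm T}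
      (posSqrt P * posSqrt P) :=
    (contDiffAt_localSqrtAt hS).contDiffWithinAt
  rw [hSS] at h1
  refine h1.congr_of_eventuallyEq ?_ ?_
  · have h2 := eventually_posSqrt_eq_localSqrtAt hS
    rw [hSS] at h2
    have h3 : ∀ᶠ X in 𝓝[{T : V →L[ℝ] V | IsPosDefSymm T}] P, IsPosDefSymm X :=
      eventually_mem_nhdsWithin
    filter_upwards [eventually_nhdsWithin_of_eventually_nhds h2, h3] with X hX hmem
    exact hX hmem
  · have h2 := (eventually_posSqrt_eq_localSqrtAt hS).self_of_nhds
    rw [hSS] at h2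
    exact h2 hP

/-- **The positive square root is `C^∞` on the symmetric positive definite operators.**
[cite: McDuffSalamon2017, Exercise 2.5.15] -/
theorem contDiffOn_posSqrt : ContDiffOn ℝ ∞ posSqrt {T : V →L[ℝ] V | IsPosDefSymm T} :=
  fun _ hP ↦ contDiffWithinAt_posSqrt hP

/-- **The inverse square root `P ↦ (√P)⁻¹` is `C^∞` on the symmetric positive definite
operators** (inversion is smooth at units). This is the smoothness of `Q_{g,ω}⁻¹ = (-A²)^{-1/2}`
in McDuff–Salamon's `J_{g,ω} = Q⁻¹ A`. [cite: McDuffSalamon2017, Exercise 2.5.15] -/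
theorem contDiffOn_inverse_posSqrt :
    ContDiffOn ℝ ∞ (fun T : V →L[ℝ] V ↦ Ring.inverse (posSqrt T)) {T : V →L[ℝ] V | IsPosDefSymm T} := by
  intro P hP
  have hu : IsUnit (posSqrt P) := (IsPosDefSymm.isPosDefSymm_posSqrt hP).isUnit
  obtain ⟨u, hu'⟩ := hu
  have h1 : ContDiffAt ℝ ∞ Ring.inverse (posSqrt P) := by
    rw [← hu']
    exact contDiffAt_ringInverse ℝ u
  exact h1.comp_contDiffWithinAt P (contDiffWithinAt_posSqrt hP)

end Smooth

end Literature.Analysis.OperatorTheory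

end
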